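import Summits.CriticalPhenomena.PercolationContinuityZ3.Theorems.Transplant.FKConnectivityAllQAntipodalUpc
import HarnessLib

/-!
# `C_∞` FOR THE CONJUNCTION TYPE ON A TRIANGLE — `and₃` / `or₃` of the three edges of a triangle of a series–parallel graph

Theorem file (`--supports stmt-CriticalPhenomena-4575`), FK sub-lane `prim-bschramm-fk-2` (gen 17); builds on p205010 (kernel
theorem, internal audit signed; external expert review pending).  No named facts, no sorries, standard axioms.

Gen 11 reduced Conjecture `C_∞` at `|supp f| = 3` to the two types `maj₃` (closed by gen 17's `…AntipodalMaj3` from Conjecture U¹¹) and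
`and₃`: `apPsi q H (1_x 1_y 1_z) g = 2 a_S ≤ 0` with the AND-DRIFT `a_S = ∑_{ω ⊇ S} q^{k(ω)+k(H∖ω)} (g ω - g(H∖ω))`, `S = {x, y, z}`
(memo `FROM-fk-2-g11-ANTIPODAL-UPC.md` §3.6).  Gen 17 observed (memo `FROM-fk-2-g17-AND-MULTITERMINAL.md` §2) that `a_S` depends on
`S` only through the graph `H ∖ S` and the way `S` connects its own vertex set: for a TRIANGLE `S = {st, tv, sv}` the drift equals the
drift of the PATH `{st, tv}` in the graph `H ∖ {sv}` — the third edge is redundant for the cluster count on the side that contains the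
other two, and absent on the side that contains none.  The path case is `C_∞` at `|supp f| = 2` (`FK.apPsi_two_edges_nonpos_of_isTTSP`,
gen 11).  This file types exactly that:
* `FK.clusterCount_insert_of_reachable` — adding an edge between already-connected vertices does not change the cluster count;
* `FK.apPsi_and3_triangle_eq` — `apPsi q (H ∪ {sv}) (1_{st} 1_{tv} 1_{sv}) g = apPsi q H (1_{st} 1_{tv}) g` for `sv ∉ H ⊇ {st, tv}`, `g` not
  reading `sv`;
* **`FK.apPsi_and3_triangle_nonpos_of_isTTSP`** — `E` two-terminal series–parallel between `s, t`, `x = st ∉ E`, `y = tv ∈ E`,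
  `z = sv ∉ E ∪ {x}`, `0 < q ≤ 1`, `g` monotone on the sub-configurations of `E ∪ {x}` reading none of `x, y, z` ⟹
  `apPsi q (E ∪ {x, z}) (1_x 1_y 1_z) g ≤ 0`: Conjecture `C_∞` for the conjunction of the three edges of a triangle (note that
  `E ∪ {x, z}` is again series–parallel: `z` is parallel to the path `x·y`);
* `FK.apPsi_or3_triangle_nonpos_of_isTTSP` — the same for the disjunction `max(1_x, 1_y, 1_z)` (the odd increments of `f` and of its dual
  `f* = 1 - f∘(H∖·)` coincide, memo g11 §3.2).
Open after this file: `and₃` when the three edges form a path, a star, a path plus a disjoint edge, or a matching.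
[cite: Grimmett2006, §1.4 eq. (1.20) (p. 15); §3.8 Thm. (3.90) (pp. 61–62); §3.9 (pp. 63–64)] [cite: Wagner2006, Thm. 5.8(d), §5.3]
-/

noncomputable section

namespace Summit.CriticalPhenomena.PercolationContinuityZ3.Theorems

namespace FK

open SimpleGraph Literature.Probability.LatticeModels Literature.Probability.Percolation
open scoped Classical

variable {V : Type*}

section Triangle

variable [Fintype V] {s t v : V}

/-- Adding an edge between two vertices that are already joined does not change the number of open clusters.
[cite: Grimmett2006, §1.4 eq. (1.20) (p. 15)] -/
theorem clusterCount_insert_of_reachable (X : Finset (Sym2 V)) {a b : V} (h : (openGraph (↑X : BondConfig V)).Reachable a b) :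
    clusterCount (↑(insert s(a, b) X) : BondConfig V) ∅ = clusterCount (↑X : BondConfig V) ∅ := by
  have key := clusterCount_union_pair_add (↑X : BondConfig V) a b
  rw [if_pos h, add_zero] at key
  rw [Finset.coe_insert, Set.insert_eq, Set.union_comm]
  exact key

omit [Fintype V] in
/-- If `st, tv ∈ X` (with `s ≠ t`, `t ≠ v`) then `s ↔ v` in the open graph of `X`. [folklore] -/
theorem reachable_of_two_edges {X : Finset (Sym2 V)} (hst : s ≠ t) (htv : t ≠ v) (hx : s(s, t) ∈ X) (hy : s(t, v) ∈ X) :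
    (openGraph (↑X : BondConfig V)).Reachable s v :=
  (Adj.reachable ((openGraph_adj _ s t).2 ⟨Finset.mem_coe.2 hx, hst⟩)).trans
    (Adj.reachable ((openGraph_adj _ t v).2 ⟨Finset.mem_coe.2 hy, htv⟩))

/-- **The triangle reduces to the path.**  For `H ⊆` edges with `z = sv ∉ H` and a test function `g` not reading `z`:
`apPsi q (H ∪ {z}) (1_{st} 1_{tv} 1_{sv}) g = apPsi q H (1_{st} 1_{tv}) g` (`s ≠ t`, `t ≠ v`).  Pointwise in `γ ⊆ H`: the pair
`(γ, (H ∪ {z}) ∖ γ)` contributes only through the side containing `st, tv`, where `z` would be redundant for the cluster count, and the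
pair `(γ ∪ {z}, H ∖ γ)` likewise. [cite: Grimmett2006, §1.4 eq. (1.20) (p. 15)] -/
theorem apPsi_and3_triangle_eq (q : ℝ) {H : Finset (Sym2 V)} (hst : s ≠ t) (htv : t ≠ v) (hz : s(s, v) ∉ H)
    {g : Finset (Sym2 V) → ℝ} (hg : ∀ A : Finset (Sym2 V), g (insert s(s, v) A) = g A) :
    apPsi q (insert s(s, v) H) (fun A => if s(s, t) ∈ A ∧ s(t, v) ∈ A ∧ s(s, v) ∈ A then 1 else 0) g =
      apPsi q H (fun A => if s(s, t) ∈ A ∧ s(t, v) ∈ A then 1 else 0) g := by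
  unfold apPsi
  rw [Finset.sum_powerset_insert hz, ← Finset.sum_add_distrib]
  refine Finset.sum_congr rfl fun γ hγ => ?_
  have hγH : γ ⊆ H := Finset.mem_powerset.1 hγ
  have hzγ : s(s, v) ∉ γ := fun h => hz (hγH h)
  have hzc : s(s, v) ∉ H \ γ := fun h => hz (Finset.sdiff_subset h)
  have e1 : insert s(s, v) H \ γ = insert s(s, v) (H \ γ) := Finset.insert_sdiff_of_notMem H hzγ
  have e2 : insert s(s, v) H \ insert s(s, v) γ = H \ γ := by
    rw [Finset.insert_sdiff_insert, Finset.sdiff_insert_of_notMem hz]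
  rw [e1, e2]
  simp only [hzγ, hzc, Finset.mem_insert_self, and_true, and_false, if_false, hg]
  -- membership of `st`, `tv` in `insert sv X` is membership in `X`
  have m1 : ∀ X : Finset (Sym2 V), (s(s, t) ∈ insert s(s, v) X ↔ s(s, t) ∈ X) := fun X => by
    rw [Finset.mem_insert, or_iff_right]
    intro h
    have := Sym2.eq_iff.1 h
    rcases this with ⟨-, h2⟩ | ⟨h1, h2⟩
    · exact htv h2
    · exact htv (h2 ▸ h1.symm ▸ rfl)
  have m2 : ∀ X : Finset (Sym2 V), (s(t, v) ∈ insert s(s, v) X ↔ s(t, v) ∈ X) := fun X => by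
    rw [Finset.mem_insert, or_iff_right]
    intro h
    have := Sym2.eq_iff.1 h
    rcases this with ⟨h1, -⟩ | ⟨h1, h2⟩
    · exact hst h1.symm
    · exact hst (h2 ▸ h1 ▸ rfl)
  simp only [m1, m2]
  -- the two exponents, corrected by the redundancy of `z`
  by_cases a1 : s(s, t) ∈ γ ∧ s(t, v) ∈ γ
  · have k1 : apExp (insert s(s, v) H) (insert s(s, v) γ) = apExp H γ := by
      unfold apExp
      rw [e2, clusterCount_insert_of_reachable γ (reachable_of_two_edges hst htv a1.1 a1.2)]
    by_cases a2 : s(s, t) ∈ H \ γ ∧ s(t, v) ∈ H \ γ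
    · exact absurd a1.1 (Finset.mem_sdiff.1 a2.1).2
    · rw [k1]; simp only [a1, a2, and_self, if_true, if_false]; ring
  · by_cases a2 : s(s, t) ∈ H \ γ ∧ s(t, v) ∈ H \ γ
    · have k2 : apExp (insert s(s, v) H) γ = apExp H γ := by
        unfold apExp
        rw [e1, clusterCount_insert_of_reachable (H \ γ) (reachable_of_two_edges hst htv a2.1 a2.2)]
      rw [k2]; simp only [a1, a2, and_self, if_true, if_false]; ring
    · simp only [a1, a2, if_false]; ring

/-- **`C_∞` FOR `and₃` ON A TRIANGLE (`0 < q ≤ 1`).**  `E` two-terminal series–parallel between `s, t`, `x = st ∉ E`, `y = tv ∈ E`,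
`z = sv ∉ E ∪ {x}`, `g` monotone on the sub-configurations of `E ∪ {x}` reading none of `x, y, z` ⟹
`apPsi q (E ∪ {x, z}) (1_x 1_y 1_z) g = ∑_γ q^{k(γ)+k(γᶜ)} (1_{xyz ⊆ γ} - 1_{xyz ⊆ γᶜ}) (g γ - g γᶜ) ≤ 0`, i.e. the AND-drift
`a_{xyz} ≤ 0`: every square-free top coefficient of `Z² Cov_{φ_{z,q}}(ω_x ω_y ω_z, g)` for a triangle `xyz` of a series–parallel graph is `≤ 0`.
Proof: `FK.apPsi_and3_triangle_eq` and `FK.apPsi_two_edges_nonpos_of_isTTSP`.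
[cite: Grimmett2006, §3.8 Thm. (3.90) (pp. 61–62); §3.9 (pp. 63–64)] [cite: Wagner2006, Thm. 5.8(d), §5.3] -/
theorem apPsi_and3_triangle_nonpos_of_isTTSP {q : ℝ} (hq0 : 0 < q) (hq1 : q ≤ 1) {E : Finset (Sym2 V)} (hE : IsTTSP E s t)
    (hx : s(s, t) ∉ E) (hy : s(t, v) ∈ E) (hz : s(s, v) ∉ insert s(s, t) E)
    {g : Finset (Sym2 V) → ℝ} (hgx : ∀ A : Finset (Sym2 V), g (insert s(s, t) A) = g A)
    (hgy : ∀ A : Finset (Sym2 V), g (insert s(t, v) A) = g A) (hgz : ∀ A : Finset (Sym2 V), g (insert s(s, v) A) = g A)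
    (hmono : ∀ ⦃A B : Finset (Sym2 V)⦄, A ⊆ B → B ⊆ insert s(s, t) E → g A ≤ g B) :
    apPsi q (insert s(s, v) (insert s(s, t) E))
        (fun A => if s(s, t) ∈ A ∧ s(t, v) ∈ A ∧ s(s, v) ∈ A then 1 else 0) g ≤ 0 := by
  have htv : t ≠ v := fun h => hE.not_isDiag hy (Sym2.mk_isDiag_iff.2 h)
  rw [apPsi_and3_triangle_eq q hE.ne htv hz hgz]
  exact apPsi_two_edges_nonpos_of_isTTSP hq0 hq1 hE hx hy hgx hgy hmono

/-- **`C_∞` FOR `or₃` ON A TRIANGLE (`0 < q ≤ 1`)**: the same bound for the disjunction `max(1_x, 1_y, 1_z)` — its odd increment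
`f(γ) - f(γᶜ)` coincides with that of the conjunction (`f* = 1 - f∘(·ᶜ)` has `F_{f*} = F_f`), so the two covariance forms are equal
termwise. [cite: Grimmett2006, §3.9 (pp. 63–64)] [cite: Wagner2006, Thm. 5.8(d), §5.3] -/
theorem apPsi_or3_triangle_nonpos_of_isTTSP {q : ℝ} (hq0 : 0 < q) (hq1 : q ≤ 1) {E : Finset (Sym2 V)} (hE : IsTTSP E s t)
    (hx : s(s, t) ∉ E) (hy : s(t, v) ∈ E) (hz : s(s, v) ∉ insert s(s, t) E)
    {g : Finset (Sym2 V) → ℝ} (hgx : ∀ A : Finset (Sym2 V), g (insert s(s, t) A) = g A)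
    (hgy : ∀ A : Finset (Sym2 V), g (insert s(t, v) A) = g A) (hgz : ∀ A : Finset (Sym2 V), g (insert s(s, v) A) = g A)
    (hmono : ∀ ⦃A B : Finset (Sym2 V)⦄, A ⊆ B → B ⊆ insert s(s, t) E → g A ≤ g B) :
    apPsi q (insert s(s, v) (insert s(s, t) E))
        (fun A => if s(s, t) ∈ A ∨ s(t, v) ∈ A ∨ s(s, v) ∈ A then 1 else 0) g ≤ 0 := by
  have key := apPsi_and3_triangle_nonpos_of_isTTSP hq0 hq1 hE hx hy hz hgx hgy hgz hmono
  have hxH : s(s, t) ∈ insert s(s, v) (insert s(s, t) E) := Finset.mem_insert_of_mem (Finset.mem_insert_self _ _)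
  have hyH : s(t, v) ∈ insert s(s, v) (insert s(s, t) E) := Finset.mem_insert_of_mem (Finset.mem_insert_of_mem hy)
  have hzH : s(s, v) ∈ insert s(s, v) (insert s(s, t) E) := Finset.mem_insert_self _ _
  have heq : apPsi q (insert s(s, v) (insert s(s, t) E)) (fun A => if s(s, t) ∈ A ∨ s(t, v) ∈ A ∨ s(s, v) ∈ A then 1 else 0) g =
      apPsi q (insert s(s, v) (insert s(s, t) E)) (fun A => if s(s, t) ∈ A ∧ s(t, v) ∈ A ∧ s(s, v) ∈ A then 1 else 0) g := by
    unfold apPsi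
    refine Finset.sum_congr rfl fun γ hγ => ?_
    set H := insert s(s, v) (insert s(s, t) E)
    have cx : s(s, t) ∈ H \ γ ↔ s(s, t) ∉ γ := by rw [Finset.mem_sdiff]; exact ⟨fun h => h.2, fun h => ⟨hxH, h⟩⟩
    have cy : s(t, v) ∈ H \ γ ↔ s(t, v) ∉ γ := by rw [Finset.mem_sdiff]; exact ⟨fun h => h.2, fun h => ⟨hyH, h⟩⟩
    have cz : s(s, v) ∈ H \ γ ↔ s(s, v) ∉ γ := by rw [Finset.mem_sdiff]; exact ⟨fun h => h.2, fun h => ⟨hzH, h⟩⟩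
    simp only [cx, cy, cz]
    by_cases a : s(s, t) ∈ γ <;> by_cases b : s(t, v) ∈ γ <;> by_cases c : s(s, v) ∈ γ <;>
    simp only [a, b, c, and_self, and_true, and_false, or_self, or_true, or_false, if_true, if_false,
      not_true_eq_false, not_false_eq_true] <;> ring
  rw [heq]; exact key

end Triangle

end FK

end Summit.CriticalPhenomena.PercolationContinuityZ3.Theorems

end
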